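import Literature.NumberTheory.GelbartRogawski1991.LocalDoubledRationalFrameSiegel
import Literature.NumberTheory.GelbartRogawski1991.LocalDoubledRationalFrameModels
import Literature.NumberTheory.GelbartRogawski1991.LocalSplittingCMScaleTransport
import Literature.NumberTheory.GelbartRogawski1991.LocalKudlaSplittingRigiditySplit
import Literature.NumberTheory.GelbartRogawski1991.LocalSplittingCMGaloisTransportRigidity
import Literature.NumberTheory.GelbartRogawski1991.LocalUnitaryUndoublingTransport
import Literature.RepresentationTheory.HeisenbergGroup.MetaplecticBoxHom
import HarnessLib

/-!
# Rational-frame naturality of the CM local package: `frameSection_P (s_{T₀}) = s_{PᵀT₀P}`, doubled and undoubled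

Topic `NumberTheory/GelbartRogawski1991`; namespace `Literature.NumberTheory.GelbartRogawski1991.UnitaryDualPair.LocalSplitting`.  KERNEL ONLY:
theorems; no definition, no named fact, no `sorry`.  Cell `hodgecm-mathlib` (D-0151), programme P2 (crux H413 = stmt-HodgeConjecture-24833), brick
**(FN) «RATIONAL-FRAME NATURALITY OF THE CM LOCAL PACKAGE»** of the N3 road (letter #96 `GelbartRogawski1991.thetaType_nonsplit_jacquetModule`;
lead B-p18 (g29), dealt 2026-08-31; consumers: the (N-iii) assembler «`ν` read in the block model», the (LM) line matching, the (FX) frame transport of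
the (E4) dictionary).

THE MATHEMATICS ([Kudla1994, §3 Thm. 3.1]; [HarrisKudlaSweet1996, §1 (1.11)–(1.16)]; [GelbartRogawski1991, §3.1 Prop. 3.1.1 p. 455, Remark p. 457];
[MoeglinVignerasWaldspurger1987, Chap. 2 II Remarque (3)]).  `L` CM, `F = L⁺`, `v` ANY finite place of `F`, `T₀, T₀' ∈ Sym_n(F)` invertible with `T₀'`
DIAGONAL and `n ≥ 1`, a RATIONAL frame `P ∈ GL_n(F)` with `Pᵀ T₀ P = T₀'` (an `F`-isometry `(Fⁿ, T₀') → (Fⁿ, T₀)`), `χ` a splitting Hecke character of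
`L`, Haar data `μ` on `F_v`.  The tree's CM local package at `T₀` is the undoubled section `s_{T₀} = localSplittingCMWith … T₀ … v μ : U(T₀ ⊗ 1)(F_v) →*
S̃p_ψ(𝕎_{T₀,v})` (★ `LocalUnitarySplittingsCM`), the undoubling (★ `undoubleLoc`) of Kudla's `P_Δ`-normalised splitting `Σ_{T₀} = (localSplittingDatumCM …
T₀ …).localSplitting` of the DOUBLED group `U(T₀^𝔻 ⊗ 1)(F_v)`.  The tree's ★ `FrameTransport` moves sections along `P`: `frameSection_P s := frameMp_P⁻¹ ∘ s
∘ (g' ↦ P g' P⁻¹)`, with Weil operators `ω_{frameSection s}(g') = frameOp⁻¹ ∘ ω_s(P g' P⁻¹) ∘ frameOp`, `frameOp f = f ∘ P⁻¹`.  THIS FILE: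

* (N) `parabolic_toRep_conj_frameSection_localSplittingDatumCM` — the doubled section of `T₀` transported along the DOUBLED frame `PD = P ⊕ P` (★
  `LocalDoubledRationalFrameSiegel` ∕ `…Models`: `PDᵀ T₀^𝔻 PD = T₀'^𝔻`) satisfies the `P_Δ`-normalisation of `U(T₀'^𝔻 ⊗ 1)(F_v)` with the SAME scalar
  `χ_v(det_Δ p)⁻¹ ∏_w ‖det_Δ p_w‖^{1/2}` at every mover of `ℓ_Δ` onto `ℓ_Y` (`Ad(PD)` preserves `P_Δ` and `det_Δ`, `frameMp_{PD}` carries movers to movers,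
  `frameOp` fixes values at `0`);
* **(D) `frameSection_localSplittingDatumCM`** — hence, by Kudla's rigidity (★ `eq_of_parabolic_toRep_conj_eq`; every character of `U(T₀'^𝔻 ⊗ 1)(F_v)` trivial
  on `P_Δ` is trivial at EVERY finite place, ★ `eq_one_of_forall_isSiegelDelta_eq_one'`): **`frameSection_{PD} Σ_{T₀} = Σ_{T₀'}`**;
* **(U) `frameOp_toRep_localSplittingCMWith`** — the UNDOUBLED operator identity **`frameOp_P (ω_{s_{T₀'}}(g') f) = ω_{s_{T₀}}(P g' P⁻¹) (frameOp_P f)`**, i.e.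
  `ω_{T₀'}(s_{T₀'} g') = frameOp⁻¹ ∘ ω_{T₀}(s_{T₀}(P g' P⁻¹)) ∘ frameOp` (descent of (D) through undoubling, ★ `apply_toRep_undoubleLoc_eq_of_box_transport`:
  `frameOp_{PD}` is `⊠`-multiplicative and `PD (g' ⊕ 1) PD⁻¹ = (P g' P⁻¹) ⊕ 1`);
* **(S) `frameSection_localSplittingCMWith`** — the SECTION identity **`frameSection_P s_{T₀} = s_{T₀'}`** (equal projections `ι_{T₀'}`, equal operators by
  (U)).
No non-split hypothesis; `T₀` need not be diagonal.  With ★ `RankOneThetaLiftFrameTwist.exists_coinvFrameEquiv` the consumers get `Θ_{s_{T₀}}(χ') ≅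
Θ_{s_{T₀'}}(χ')` along `frameOp⁻¹`, equivariantly along `g' ↦ P g' P⁻¹`.  Nothing of the cited sources is asserted; HC_CM is proved only modulo the
printed citations until rung 0 closes.

## References
* [Kudla1994] S. Kudla, *Splitting metaplectic covers of dual reductive pairs*, Israel J. Math. 87 (1994), §3 Thm. 3.1.
* [HarrisKudlaSweet1996] M. Harris, S. Kudla, W. Sweet, J. AMS 9 (1996), §1 (1.11)–(1.16).
* [GelbartRogawski1991] S. Gelbart, J. Rogawski, Invent. Math. 105 (1991), §3.1 Prop. 3.1.1 p. 455 L1–3, Remark p. 457 L4–13.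
* [MoeglinVignerasWaldspurger1987] LNM 1291 (1987), Chap. 2 I.7, II.1 Rem. (6), II Remarque (3).
* [PlatonovRapinchuk1994] V. Platonov, A. Rapinchuk, Algebraic Groups and Number Theory (1994), §2.3.
-/

set_option autoImplicit false
-- buildfix G11b-3 recipe (LEDGER B13-1/B13-3), as in the GelbartRogawski1991 siblings: elaborate sequentially.
set_option Elab.async false

noncomputable section

open scoped Matrix
open NumberField IsDedekindDomain MeasureTheory Matrix
open Literature.RepresentationTheory.HeisenbergGroup
open Literature.NumberTheory.Automorphic Literature.NumberTheory.Automorphic.UnitaryGroup Literature.NumberTheory.Weil1964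
open Literature.NumberTheory.GaloisRepresentations Literature.RepresentationTheory.HarrisKudlaSweet1996

namespace Literature.NumberTheory.GelbartRogawski1991.UnitaryDualPair.LocalSplitting

variable (L : Type) [Field L] [NumberField L] [IsCMField L] (v : HeightOneSpectrum (𝓞 (maximalRealSubfield L)))
  [MeasurableSpace (v.adicCompletion (maximalRealSubfield L))] [BorelSpace (v.adicCompletion (maximalRealSubfield L))]
  (μ : Measure (v.adicCompletion (maximalRealSubfield L))) [μ.IsAddHaarMeasure]
  (n : ℕ) {T₀ T₀' : Matrix (Fin n) (Fin n) (maximalRealSubfield L)}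

/-! ## §1 (N) The frame-transported doubled CM section is `P_Δ`-normalised with the same scalar -/

set_option synthInstance.maxHeartbeats 400000 in
set_option maxHeartbeats 4000000 in
/-- **(N) the doubled CM section of `T₀`, transported along `PD = P ⊕ P`, satisfies the parabolic normalisation of `U(T₀'^𝔻 ⊗ 1)(F_v)` with the scalar
`χ_v(det_Δ p)⁻¹ · ∏_w ‖det_Δ p_w‖_w^{1/2}`** at every mover `m` of `ℓ_Δ` onto `ℓ_Y`: `m · frameSection(Σ)(p) · m⁻¹ = frameMp⁻¹((frameMp m) Σ(PD p PD⁻¹) (frameMp m)⁻¹)`,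
`frameMp m` is a mover for `T₀^𝔻`, `PD p PD⁻¹ ∈ P_Δ` with the same `det_Δ`, and `frameOp^{±1}` fix the value at `0`.
[cite: Kudla1994, §3 Thm 3.1] [cite: HarrisKudlaSweet1996, §1 (1.16)] [cite: MoeglinVignerasWaldspurger1987, Chap. 2 II Remarque (3)] -/
theorem parabolic_toRep_conj_frameSection_localSplittingDatumCM (hT₀ : T₀.IsSymm) (hT₀d : IsUnit T₀.det) (hT₀' : T₀'.IsSymm)
    (P : GL (Fin n) (maximalRealSubfield L))
    (hP : ((P : Matrix (Fin n) (Fin n) (maximalRealSubfield L)))ᵀ * T₀ * (P : Matrix (Fin n) (Fin n) (maximalRealSubfield L)) = T₀')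
    {PD : GL (Fin (n + n)) (maximalRealSubfield L)} (hPD : PD = UnitaryGroup.reindexGL (e₂ n) (UnitaryGroup.blockDiagGL (P, P)))
    {JD JD' : Matrix (Fin (n + n)) (Fin (n + n)) L}
    (hJD : JD = (gramD (maximalRealSubfield L) n T₀).map (algebraMap (maximalRealSubfield L) L))
    (hJD' : JD' = (gramD (maximalRealSubfield L) n T₀').map (algebraMap (maximalRealSubfield L) L))
    (χ : HeckeCharacter L) (hχ : IsSplittingChar L 1 χ)
    (m : LocalMp (maximalRealSubfield L) (n + n) (gramD (maximalRealSubfield L) n T₀') v)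
    (hm : (deltaLagrangian (maximalRealSubfield L) v n).map (toLin (maximalRealSubfield L) v (MpPsi.proj _ m)) =
      lagrangianY (maximalRealSubfield L) (n + n) v)
    (p : UnitaryGroup.localPi L (IsCMField.complexConj L) (n + n) JD' v)
    (hp : IsSiegelDelta (maximalRealSubfield L) L (IsCMField.complexConj L) (complexConj_imagUnit L) (imagUnit_ne_zero L)
      (imagUnit_mul_self L) v n hT₀' hJD' p)
    (Φ : SchwartzBruhat (Fin (n + n) → v.adicCompletion (maximalRealSubfield L))) :
    ((MpPsi.toRep (localSchrodinger (maximalRealSubfield L) (n + n) (gramD (maximalRealSubfield L) n T₀') v)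
          (m * FrameTransport.frameSection (maximalRealSubfield L) L (IsCMField.complexConj L) v (n + n) hJD hJD' PD
              (transpose_pd_mul_gramD_mul_pd (maximalRealSubfield L) n P hP hPD)
              (localSplittingDatumCM L v μ n hT₀ hT₀d hJD χ hχ).localSplitting p * m⁻¹) Φ :
        SchwartzBruhat (Fin (n + n) → v.adicCompletion (maximalRealSubfield L))) :
        (Fin (n + n) → v.adicCompletion (maximalRealSubfield L)) → ℂ) 0 =
      (((chiDet (maximalRealSubfield L) L (IsCMField.complexConj L) v n
            (fun w' : PlacesOver L v => (χ.localComponent w'.1)⁻¹) p)⁻¹ : ℂˣ) : ℂ) *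
        ((∏ w' : PlacesOver L v,
            Real.sqrt ‖detDelta (maximalRealSubfield L) L (IsCMField.complexConj L) v n w' p‖ : ℝ) : ℂ) *
        ((Φ : SchwartzBruhat (Fin (n + n) → v.adicCompletion (maximalRealSubfield L))) :
          (Fin (n + n) → v.adicCompletion (maximalRealSubfield L)) → ℂ) 0 := by
  -- conjugation by `m` is `frameMp⁻¹` of conjugation by `frameMp m`
  have hconj : m * FrameTransport.frameSection (maximalRealSubfield L) L (IsCMField.complexConj L) v (n + n) hJD hJD' PD
        (transpose_pd_mul_gramD_mul_pd (maximalRealSubfield L) n P hP hPD) (localSplittingDatumCM L v μ n hT₀ hT₀d hJD χ hχ).localSplitting p * m⁻¹ =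
      (FrameTransport.frameMp (maximalRealSubfield L) v (n + n) PD (transpose_pd_mul_gramD_mul_pd (maximalRealSubfield L) n P hP hPD)).symm
        (FrameTransport.frameMp (maximalRealSubfield L) v (n + n) PD (transpose_pd_mul_gramD_mul_pd (maximalRealSubfield L) n P hP hPD) m *
          (localSplittingDatumCM L v μ n hT₀ hT₀d hJD χ hχ).localSplitting
            (FrameTransport.frameConj (maximalRealSubfield L) L (IsCMField.complexConj L) v (n + n) hJD hJD' PD
              (transpose_pd_mul_gramD_mul_pd (maximalRealSubfield L) n P hP hPD) p) *
          (FrameTransport.frameMp (maximalRealSubfield L) v (n + n) PD (transpose_pd_mul_gramD_mul_pd (maximalRealSubfield L) n P hP hPD) m)⁻¹) := by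
    rw [map_mul, map_mul, map_inv, MulEquiv.symm_apply_apply, FrameTransport.frameSection_apply]
  -- `PD p PD⁻¹ ∈ P_Δ(T₀^𝔻)` and `frameMp m` is a mover for `T₀^𝔻`
  have hp' : IsSiegelDelta (maximalRealSubfield L) L (IsCMField.complexConj L) (complexConj_imagUnit L) (imagUnit_ne_zero L)
      (imagUnit_mul_self L) v n hT₀ hJD
      (FrameTransport.frameConj (maximalRealSubfield L) L (IsCMField.complexConj L) v (n + n) hJD hJD' PD
        (transpose_pd_mul_gramD_mul_pd (maximalRealSubfield L) n P hP hPD) p) :=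
    (isSiegelDelta_frameConj_pd_iff (maximalRealSubfield L) L (IsCMField.complexConj L) v n hJD hJD' P hP hPD (complexConj_imagUnit L)
      (imagUnit_ne_zero L) (imagUnit_mul_self L) hT₀ hT₀' p).2 hp
  have hm' := map_proj_frameMp_pd_deltaLagrangian (maximalRealSubfield L) v n P hPD (transpose_pd_mul_gramD_mul_pd (maximalRealSubfield L) n P hP hPD) m hm
  rw [hconj, FrameTransport.toRep_frameMp_symm_apply, coe_frameOp_symm_apply_zero,
    parabolic_toRep_conj_localSplittingDatumCM L v μ n hT₀ hT₀d hJD χ hχ _ hm' _ hp' _,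
    chiDet_frameConj_pd (maximalRealSubfield L) L (IsCMField.complexConj L) v n hJD hJD' P hP hPD,
    coe_frameOp_apply_zero]
  congr 2
  push_cast
  exact Finset.prod_congr rfl fun w' _ => by
    rw [norm_detDelta_frameConj_pd (maximalRealSubfield L) L (IsCMField.complexConj L) v n hJD hJD' P hP hPD p w']

/-! ## §2 (D) The doubled identity: `frameSection_{PD} Σ_{T₀} = Σ_{T₀'}` -/

set_option synthInstance.maxHeartbeats 400000 in
set_option maxHeartbeats 4000000 in
/-- **(D) RATIONAL-FRAME NATURALITY, DOUBLED LEVEL.**  For `T₀, T₀' ∈ Sym_n(F)` invertible with `T₀'` diagonal, `n ≥ 1`, a rational frame `Pᵀ T₀ P = T₀'`,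
`PD = P ⊕ P`, and a splitting Hecke character `χ`, at EVERY finite place `v`: the Kudla-normalised doubled CM section of `T₀` transported along `PD`
IS the Kudla-normalised doubled CM section of `T₀'` — both are `P_Δ`-normalised homomorphic sections of `U(T₀'^𝔻 ⊗ 1)(F_v)` over `ι^𝔻` with the same
scalar ((N) + ★ `parabolic_toRep_conj_localSplittingDatumCM`), and Kudla's rigidity applies (★ `eq_of_parabolic_toRep_conj_eq`, ★
`eq_one_of_forall_isSiegelDelta_eq_one'`, ★ `exists_mover_deltaLagrangian`).
[cite: Kudla1994, §3 Thm 3.1] [cite: GelbartRogawski1991, §3.1 Remark p. 457 L4–13] [cite: MoeglinVignerasWaldspurger1987, Chap. 2 II Remarque (3)] -/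
theorem frameSection_localSplittingDatumCM (hn : 0 < n) (t' : Fin n → maximalRealSubfield L) (hT₀'t : T₀' = Matrix.diagonal t')
    (hT₀ : T₀.IsSymm) (hT₀d : IsUnit T₀.det) (hT₀' : T₀'.IsSymm) (hT₀'d : IsUnit T₀'.det)
    (P : GL (Fin n) (maximalRealSubfield L))
    (hP : ((P : Matrix (Fin n) (Fin n) (maximalRealSubfield L)))ᵀ * T₀ * (P : Matrix (Fin n) (Fin n) (maximalRealSubfield L)) = T₀')
    {PD : GL (Fin (n + n)) (maximalRealSubfield L)} (hPD : PD = UnitaryGroup.reindexGL (e₂ n) (UnitaryGroup.blockDiagGL (P, P)))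
    {JD JD' : Matrix (Fin (n + n)) (Fin (n + n)) L}
    (hJD : JD = (gramD (maximalRealSubfield L) n T₀).map (algebraMap (maximalRealSubfield L) L))
    (hJD' : JD' = (gramD (maximalRealSubfield L) n T₀').map (algebraMap (maximalRealSubfield L) L))
    (χ : HeckeCharacter L) (hχ : IsSplittingChar L 1 χ) :
    FrameTransport.frameSection (maximalRealSubfield L) L (IsCMField.complexConj L) v (n + n) hJD hJD' PD
        (transpose_pd_mul_gramD_mul_pd (maximalRealSubfield L) n P hP hPD)
        (localSplittingDatumCM L v μ n hT₀ hT₀d hJD χ hχ).localSplitting =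
      (localSplittingDatumCM L v μ n hT₀' hT₀'d hJD' χ hχ).localSplitting := by
  -- a mover of `ℓ_Δ` onto `ℓ_Y` for `T₀'^𝔻`
  obtain ⟨m₀, hm₀⟩ := exists_mover_deltaLagrangian (maximalRealSubfield L) v n hT₀'d
  refine eq_of_parabolic_toRep_conj_eq (maximalRealSubfield L) L (IsCMField.complexConj L) (complexConj_imagUnit L)
    (imagUnit_ne_zero L) (imagUnit_mul_self L) v n hT₀' hT₀'d hJD'
    (localSplittingDatumCM L v μ n hT₀' hT₀'d hJD' χ hχ).localSplitting _ (fun g => ?_) (fun θ hθ => ?_)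
    (fun p => (((chiDet (maximalRealSubfield L) L (IsCMField.complexConj L) v n
        (fun w' : PlacesOver L v => (χ.localComponent w'.1)⁻¹) p)⁻¹ : ℂˣ) : ℂ) *
      ((∏ w' : PlacesOver L v,
        Real.sqrt ‖detDelta (maximalRealSubfield L) L (IsCMField.complexConj L) v n w' p‖ : ℝ) : ℂ))
    (fun p hp => ?_) m₀ (fun p hp Φ => ?_) (fun p hp Φ => ?_)
  · -- both sections lie over `ι^𝔻_{T₀'}`
    rw [LocalSplittingDatum.proj_localSplitting]
    exact FrameTransport.proj_frameSection (maximalRealSubfield L) L (IsCMField.complexConj L) v (n + n) hJD hJD' PD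
      (transpose_pd_mul_gramD_mul_pd (maximalRealSubfield L) n P hP hPD) _ (complexConj_imagUnit L) (imagUnit_ne_zero L)
      (imagUnit_mul_self L) (gramD_isSymm (maximalRealSubfield L) n hT₀) (gramD_isSymm (maximalRealSubfield L) n hT₀')
      (localSplittingDatumCM L v μ n hT₀ hT₀d hJD χ hχ).proj_localSplitting g
  · -- every character of `H'(F_v)` trivial on `P_Δ` is trivial (diagonal `T₀'`, every finite place)
    exact eq_one_of_forall_isSiegelDelta_eq_one' (maximalRealSubfield L) L (IsCMField.complexConj L) (complexConj_imagUnit L)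
      (imagUnit_ne_zero L) (imagUnit_mul_self L) v n hn t' hT₀'t hT₀' hT₀'d hJD' θ hθ
  · -- the scalar does not vanish on `P_Δ`
    exact parabolicScalar_ne_zero (maximalRealSubfield L) L (IsCMField.complexConj L) (complexConj_imagUnit L)
      (imagUnit_ne_zero L) (imagUnit_mul_self L) v n hT₀' hJD' _ hp
  · -- the CM section of `T₀'` is `P_Δ`-normalised with that scalar
    exact parabolic_toRep_conj_localSplittingDatumCM L v μ n hT₀' hT₀'d hJD' χ hχ m₀ hm₀ p hp Φ
  · -- (N): so is the transported CM section of `T₀`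
    exact parabolic_toRep_conj_frameSection_localSplittingDatumCM L v μ n hT₀ hT₀d hT₀' P hP hPD hJD hJD' χ hχ m₀ hm₀ p hp Φ

/-! ## §3 (U) The undoubled operator identity -/

set_option synthInstance.maxHeartbeats 400000 in
set_option maxHeartbeats 4000000 in
/-- **(U) RATIONAL-FRAME NATURALITY, UNDOUBLED OPERATORS: `frameOp_P (ω_{s_{T₀'}}(g') f) = ω_{s_{T₀}}(P g' P⁻¹) (frameOp_P f)`** for the tree's CM local
packages `s_{T} = localSplittingCMWith … T … v μ` — i.e. `ω_{T₀'}(s_{T₀'} g') = frameOp⁻¹ ∘ ω_{T₀}(s_{T₀}(P g' P⁻¹)) ∘ frameOp` with `frameOp f = f ∘ P⁻¹`.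
Descent of (D) through undoubling (★ `apply_toRep_undoubleLoc_eq_of_box_transport`): the doubled operator identity `frameOp_{PD} ∘ ω_{T₀'^𝔻}(Σ_{T₀'}(g' ⊕ 1))
= ω_{T₀^𝔻}(Σ_{T₀}((P g' P⁻¹) ⊕ 1)) ∘ frameOp_{PD}` ((D) read through ★ `frameOp_toRep_frameSection` and ★ `frameConj_pd_inlLoc`) on products `f₁ ⊠ f₂`, and
`frameOp_{PD}(f₁ ⊠ f₂) = frameOp_P f₁ ⊠ frameOp_P f₂`.
[cite: MoeglinVignerasWaldspurger1987, Chap. 2 II.1 Rem. (6); II Remarque (3)] [cite: GelbartRogawski1991, §3.1 Prop. 3.1.1 p. 455 L1–3] [cite: Kudla1994, §3 Thm 3.1] -/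
theorem frameOp_toRep_localSplittingCMWith (hn : 0 < n) (t' : Fin n → maximalRealSubfield L) (hT₀'t : T₀' = Matrix.diagonal t')
    (hT₀ : T₀.IsSymm) (hT₀d : IsUnit T₀.det) (hT₀' : T₀'.IsSymm) (hT₀'d : IsUnit T₀'.det)
    (P : GL (Fin n) (maximalRealSubfield L))
    (hP : ((P : Matrix (Fin n) (Fin n) (maximalRealSubfield L)))ᵀ * T₀ * (P : Matrix (Fin n) (Fin n) (maximalRealSubfield L)) = T₀')
    {J J' : Matrix (Fin n) (Fin n) L} (hJ : J = T₀.map (algebraMap (maximalRealSubfield L) L))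
    (hJ' : J' = T₀'.map (algebraMap (maximalRealSubfield L) L)) (χ : HeckeCharacter L) (hχ : IsSplittingChar L 1 χ)
    (g' : UnitaryGroup.localPi L (IsCMField.complexConj L) n J' v) (f : SchwartzBruhat (Fin n → v.adicCompletion (maximalRealSubfield L))) :
    FrameTransport.frameOp (maximalRealSubfield L) v n P
        ((MpPsi.toRep (localSchrodinger (maximalRealSubfield L) n T₀' v)).comp (localSplittingCMWith L n hT₀' hT₀'d hJ' χ hχ v μ) g' f) =
      (MpPsi.toRep (localSchrodinger (maximalRealSubfield L) n T₀ v)).comp (localSplittingCMWith L n hT₀ hT₀d hJ χ hχ v μ)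
        (FrameTransport.frameConj (maximalRealSubfield L) L (IsCMField.complexConj L) v n hJ hJ' P hP g')
        (FrameTransport.frameOp (maximalRealSubfield L) v n P f) := by
  haveI : Nontrivial (SchwartzBruhat (Fin n → v.adicCompletion (maximalRealSubfield L))) := nontrivial_schwartzBruhat_pi
  obtain ⟨f₂, hf₂⟩ := exists_ne (0 : SchwartzBruhat (Fin n → v.adicCompletion (maximalRealSubfield L)))
  have hf₂' : FrameTransport.frameOp (maximalRealSubfield L) v n P f₂ ≠ 0 := fun h => hf₂ ((LinearEquiv.map_eq_zero_iff _).1 h)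
  -- (D) at `hJD = hJD' = rfl`, `PD := P ⊕ P`
  have hD := frameSection_localSplittingDatumCM L v μ n hn t' hT₀'t hT₀ hT₀d hT₀' hT₀'d P hP
    (PD := UnitaryGroup.reindexGL (e₂ n) (UnitaryGroup.blockDiagGL (P, P))) rfl rfl rfl χ hχ
  rw [MonoidHom.comp_apply, MonoidHom.comp_apply]
  exact apply_toRep_undoubleLoc_eq_of_box_transport (maximalRealSubfield L) L (IsCMField.complexConj L) v n hJ' rfl hJ rfl
    (complexConj_imagUnit L) (imagUnit_ne_zero L) (imagUnit_mul_self L) hT₀' hT₀'d hT₀ hT₀d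
    (localSplittingDatumCM L v μ n hT₀' hT₀'d rfl χ hχ).localSplitting
    (fun g => (localSplittingDatumCM L v μ n hT₀' hT₀'d rfl χ hχ).proj_localSplitting g)
    (localSplittingDatumCM L v μ n hT₀ hT₀d rfl χ hχ).localSplitting
    (fun g => (localSplittingDatumCM L v μ n hT₀ hT₀d rfl χ hχ).proj_localSplitting g)
    (fun f' => FrameTransport.frameOp (maximalRealSubfield L) v n P f')
    (fun F' => FrameTransport.frameOp (maximalRealSubfield L) v (n + n) (UnitaryGroup.reindexGL (e₂ n) (UnitaryGroup.blockDiagGL (P, P))) F')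
    f₂ _ hf₂' (fun f₁ => frameOp_pd_boxSB (maximalRealSubfield L) v n P rfl f₁ f₂) g' _
    (fun f₁ => by
      have h1 := FrameTransport.frameOp_toRep_frameSection (maximalRealSubfield L) L (IsCMField.complexConj L) v (n + n) rfl rfl
        (UnitaryGroup.reindexGL (e₂ n) (UnitaryGroup.blockDiagGL (P, P)))
        (transpose_pd_mul_gramD_mul_pd (maximalRealSubfield L) n P hP rfl)
        (localSplittingDatumCM L v μ n hT₀ hT₀d rfl χ hχ).localSplitting
        (inlLoc (maximalRealSubfield L) L (IsCMField.complexConj L) v n hJ' rfl g')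
        (boxSB (v.adicCompletion (maximalRealSubfield L)) (e₂ n) f₁ f₂)
      rw [MonoidHom.comp_apply, MonoidHom.comp_apply, hD,
        frameConj_pd_inlLoc (maximalRealSubfield L) L (IsCMField.complexConj L) v n hJ hJ' rfl rfl P hP rfl] at h1
      exact h1)
    f

/-! ## §4 (S) The undoubled section identity -/

set_option synthInstance.maxHeartbeats 400000 in
set_option maxHeartbeats 4000000 in
/-- **(S) RATIONAL-FRAME NATURALITY OF THE CM LOCAL PACKAGE: `frameSection_P (s_{T₀}) = s_{PᵀT₀P}`** — for `T₀' = Pᵀ T₀ P` diagonal invertible, `n ≥ 1`,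
`P ∈ GL_n(F)` rational, at every finite place `v`: the tree's CM section `localSplittingCMWith … T₀ … v μ` of `U(T₀ ⊗ 1)(F_v)` transported along `P`
(★ `FrameTransport.frameSection`: `frameMp_P⁻¹ ∘ s ∘ (g' ↦ P g' P⁻¹)`) IS the CM section `localSplittingCMWith … T₀' … v μ` of `U(T₀' ⊗ 1)(F_v)`: equal
projections `ι_{T₀'}` (★ `proj_frameSection`) and equal Weil operators ((U); ★ `MpPsi.ext_of_proj_of_toOp`).
[cite: GelbartRogawski1991, §3.1 Prop. 3.1.1 p. 455 L1–3; Remark p. 457 L4–13] [cite: Kudla1994, §3 Thm 3.1] [cite: MoeglinVignerasWaldspurger1987, Chap. 2 II Remarque (3)] -/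
theorem frameSection_localSplittingCMWith (hn : 0 < n) (t' : Fin n → maximalRealSubfield L) (hT₀'t : T₀' = Matrix.diagonal t')
    (hT₀ : T₀.IsSymm) (hT₀d : IsUnit T₀.det) (hT₀' : T₀'.IsSymm) (hT₀'d : IsUnit T₀'.det)
    (P : GL (Fin n) (maximalRealSubfield L))
    (hP : ((P : Matrix (Fin n) (Fin n) (maximalRealSubfield L)))ᵀ * T₀ * (P : Matrix (Fin n) (Fin n) (maximalRealSubfield L)) = T₀')
    {J J' : Matrix (Fin n) (Fin n) L} (hJ : J = T₀.map (algebraMap (maximalRealSubfield L) L))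
    (hJ' : J' = T₀'.map (algebraMap (maximalRealSubfield L) L)) (χ : HeckeCharacter L) (hχ : IsSplittingChar L 1 χ) :
    FrameTransport.frameSection (maximalRealSubfield L) L (IsCMField.complexConj L) v n hJ hJ' P hP (localSplittingCMWith L n hT₀ hT₀d hJ χ hχ v μ) =
      localSplittingCMWith L n hT₀' hT₀'d hJ' χ hχ v μ := by
  refine MonoidHom.ext fun g' => MpPsi.ext_of_proj_of_toOp ?_ ?_
  · rw [proj_localSplittingCMWith]
    exact FrameTransport.proj_frameSection (maximalRealSubfield L) L (IsCMField.complexConj L) v n hJ hJ' P hP _ (complexConj_imagUnit L)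
      (imagUnit_ne_zero L) (imagUnit_mul_self L) hT₀ hT₀' (proj_localSplittingCMWith L n hT₀ hT₀d hJ χ hχ v μ) g'
  · refine LinearEquiv.ext fun f => ?_
    change MpPsi.toRep (localSchrodinger (maximalRealSubfield L) n T₀' v)
        (FrameTransport.frameSection (maximalRealSubfield L) L (IsCMField.complexConj L) v n hJ hJ' P hP (localSplittingCMWith L n hT₀ hT₀d hJ χ hχ v μ) g') f =
      MpPsi.toRep (localSchrodinger (maximalRealSubfield L) n T₀' v) (localSplittingCMWith L n hT₀' hT₀'d hJ' χ hχ v μ g') f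
    have h2 := FrameTransport.toRep_frameSection_apply (maximalRealSubfield L) L (IsCMField.complexConj L) v n hJ hJ' P hP
      (localSplittingCMWith L n hT₀ hT₀d hJ χ hχ v μ) g' f
    have hU := frameOp_toRep_localSplittingCMWith L v μ n hn t' hT₀'t hT₀ hT₀d hT₀' hT₀'d P hP hJ hJ' χ hχ g' f
    simp only [MonoidHom.comp_apply] at h2 hU
    rw [h2, ← hU, LinearEquiv.symm_apply_apply]

end Literature.NumberTheory.GelbartRogawski1991.UnitaryDualPair.LocalSplitting

end
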